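import Mathlib
import Summits.ValiantsHypothesis.ValiantsHypothesis.Theorems.RigidityForcesSymmetryRankRigidMinimalReprLaplaceFiveSeparatedCaptureLetterDeletion

/-!
# `CaptureIneqSym` when six dimensions of cross matrices sit at one letter

A five-letter consequence of the letter-deletion count (✓ `finrank_le_slice_add_killed`): the `c`-slices of obligations are symmetric,
zero-diagonal and have row `c` zero, so they span at most `6` dimensions; if the three slots contain, in total dimension `≥ 6`,
matrices supported on the CROSS of the letter `c` (row and column `c`), the killed spans lose at least `6` dimensions and the count
closes: `finrank W ≤ Σ finrank U_i`.  This generalises the letter-flat leaf (✓ `captureIneqSym_of_row_supported`: ALL of the three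
spans on the cross of one letter, `Σ ≥ 6`) to «`6` cross dimensions at one letter, the rest of the configuration ARBITRARY».
[folklore]; item 24813 stays OPEN.
-/

set_option linter.dupNamespace false
set_option autoImplicit false

namespace Summit.ValiantsHypothesis.ValiantsHypothesis.Theorems.RigidityForcesSymmetryRankRigidMinimalRepr

namespace LaplaceFiveSeparatedCapture

open Finset

/-- A symmetric zero-diagonal matrix with row `c` zero is determined by its six entries on the other four letters. [folklore] -/
theorem eq_zero_of_row_zero_of_six_entries (M : Fin 5 → Fin 5 → ℂ) (hs : ∀ p q : Fin 5, M p q = M q p)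
    (hd : ∀ p : Fin 5, M p p = 0) (c d a b e : Fin 5) (hcov : ∀ x : Fin 5, x = c ∨ x = d ∨ x = a ∨ x = b ∨ x = e)
    (hc : ∀ q : Fin 5, M c q = 0) (h1 : M d a = 0) (h2 : M d b = 0) (h3 : M d e = 0) (h4 : M a b = 0) (h5 : M a e = 0)
    (h6 : M b e = 0) : M = 0 := by
  have hS : ∀ p q : Fin 5, (p = d ∨ p = a ∨ p = b ∨ p = e) → (q = d ∨ q = a ∨ q = b ∨ q = e) → M p q = 0 := by
    rintro p q (rfl | rfl | rfl | rfl) (rfl | rfl | rfl | rfl)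
    all_goals first
      | exact hd _
      | exact h1 | exact h2 | exact h3 | exact h4 | exact h5 | exact h6
      | (rw [hs]; first | exact h1 | exact h2 | exact h3 | exact h4 | exact h5 | exact h6)
  funext p q
  rw [Pi.zero_apply, Pi.zero_apply]
  rcases hcov p with hp | hp
  · rw [hp]; exact hc q
  rcases hcov q with hq | hq
  · rw [hq, hs]; exact hc p
  exact hS p q hp hq

/-- ★★★ **`CaptureIneqSym` WITH SIX CROSS DIMENSIONS AT ONE LETTER.**  If `C₀₁ ≤ U₀₁`, `C₀₂ ≤ U₀₂`, `C₁₂ ≤ U₁₂` consist of matrices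
supported on the cross of the letter `c` and `finrank C₀₁ + finrank C₀₂ + finrank C₁₂ ≥ 6`, then `finrank W ≤ Σ finrank U_i` — the
three spans being otherwise ARBITRARY (symmetric, any finranks, all five letters allowed). [folklore] -/
theorem captureIneqSym_of_cross_ge_six (U01 U02 U12 W C01 C02 C12 : Submodule ℂ (Fin 5 → Fin 5 → ℂ))
    (h01 : ∀ x ∈ U01, ∀ p q : Fin 5, x p q = x q p) (h02 : ∀ x ∈ U02, ∀ p q : Fin 5, x p q = x q p)
    (h12 : ∀ x ∈ U12, ∀ p q : Fin 5, x p q = x q p)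
    (c d a b e : Fin 5) (hcov : ∀ x : Fin 5, x = c ∨ x = d ∨ x = a ∨ x = b ∨ x = e)
    (hC01 : C01 ≤ U01) (hC02 : C02 ≤ U02) (hC12 : C12 ≤ U12)
    (hx01 : ∀ x ∈ C01, ∀ p q : Fin 5, p ≠ c → q ≠ c → x p q = 0)
    (hx02 : ∀ x ∈ C02, ∀ p q : Fin 5, p ≠ c → q ≠ c → x p q = 0)
    (hx12 : ∀ x ∈ C12, ∀ p q : Fin 5, p ≠ c → q ≠ c → x p q = 0)
    (h6 : 6 ≤ Module.finrank ℂ C01 + Module.finrank ℂ C02 + Module.finrank ℂ C12)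
    (hWs : ∀ μ ∈ W, ∀ s t : Fin 5, μ s t = μ t s) (hWd : ∀ μ ∈ W, ∀ s : Fin 5, μ s s = 0)
    (hWc : ∀ μ ∈ W, contractZ μ ∈ L3 U01 U02 U12) :
    Module.finrank ℂ W ≤ Module.finrank ℂ U01 + Module.finrank ℂ U02 + Module.finrank ℂ U12 := by
  obtain ⟨K01, hK01, k01, hK01c, hf01⟩ := exists_killed_span U01 C01 h01 c hC01 hx01
  obtain ⟨K02, hK02, k02, hK02c, hf02⟩ := exists_killed_span U02 C02 h02 c hC02 hx02
  obtain ⟨K12, hK12, k12, hK12c, hf12⟩ := exists_killed_span U12 C12 h12 c hC12 hx12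
  have hKc : ∀ x ∈ K01 ⊔ K02 ⊔ K12, ∀ q : Fin 5, x c q = 0 := by
    intro x hx q
    obtain ⟨y, hy, z, hz, rfl⟩ := Submodule.mem_sup.mp hx
    obtain ⟨y₁, hy₁, y₂, hy₂, rfl⟩ := Submodule.mem_sup.mp hy
    simp only [Pi.add_apply, hK01c y₁ hy₁ q, hK02c y₂ hy₂ q, hK12c z hz q, add_zero]
  -- the space of admissible `c`-slices: symmetric, zero diagonal, row `c` zero — finrank ≤ 6
  let Y : Submodule ℂ (Fin 5 → Fin 5 → ℂ) :=
    { carrier := {M | (∀ p q : Fin 5, M p q = M q p) ∧ (∀ p : Fin 5, M p p = 0) ∧ ∀ q : Fin 5, M c q = 0}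
      add_mem' := by
        rintro M N ⟨hM1, hM2, hM3⟩ ⟨hN1, hN2, hN3⟩
        exact ⟨fun p q => by simp only [Pi.add_apply, hM1 p q, hN1 p q], fun p => by
          simp only [Pi.add_apply, hM2 p, hN2 p, add_zero], fun q => by simp only [Pi.add_apply, hM3 q, hN3 q, add_zero]⟩
      zero_mem' := ⟨fun _ _ => rfl, fun _ => rfl, fun _ => rfl⟩
      smul_mem' := by
        rintro t M ⟨hM1, hM2, hM3⟩
        exact ⟨fun p q => by simp only [Pi.smul_apply, hM1 p q], fun p => by
          simp only [Pi.smul_apply, hM2 p, smul_zero], fun q => by simp only [Pi.smul_apply, hM3 q, smul_zero]⟩ }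
  have hYmem : ∀ M : Fin 5 → Fin 5 → ℂ, M ∈ Y ↔
      (∀ p q : Fin 5, M p q = M q p) ∧ (∀ p : Fin 5, M p p = 0) ∧ ∀ q : Fin 5, M c q = 0 := fun M => Iff.rfl
  have hY : ∀ μ ∈ W, (fun p q => contractZ μ p q c) ∈ Y := by
    intro μ _
    obtain ⟨hs, hd, hr, -⟩ := sliceCoord_shape μ c
    exact (hYmem _).mpr ⟨hs, hd, hr⟩
  have hY6 : Module.finrank ℂ Y ≤ 6 := by
    let ev : Fin 5 → Fin 5 → ((Fin 5 → Fin 5 → ℂ) →ₗ[ℂ] ℂ) := fun p q =>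
      (LinearMap.proj q : (Fin 5 → ℂ) →ₗ[ℂ] ℂ).comp (LinearMap.proj p : (Fin 5 → Fin 5 → ℂ) →ₗ[ℂ] (Fin 5 → ℂ))
    let wd : Fin 6 → (Fin 5 → Fin 5 → ℂ) →ₗ[ℂ] ℂ := ![ev d a, ev d b, ev d e, ev a b, ev a e, ev b e]
    let ρ : Y →ₗ[ℂ] (Fin 6 → ℂ) := (LinearMap.pi wd).comp Y.subtype
    have hρ : ∀ (M : Y) (i : Fin 6), ρ M i = wd i (M : Fin 5 → Fin 5 → ℂ) := fun M i => rfl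
    have hinj : Function.Injective ρ := by
      rw [injective_iff_map_eq_zero]
      intro M hM
      have hv : ∀ i, wd i (M : Fin 5 → Fin 5 → ℂ) = 0 := fun i => by rw [← hρ]; simp [hM]
      obtain ⟨hs, hd, hr⟩ := (hYmem _).mp M.2
      have h0 : (M : Fin 5 → Fin 5 → ℂ) = 0 :=
        eq_zero_of_row_zero_of_six_entries _ hs hd c d a b e hcov hr (hv 0) (hv 1) (hv 2) (hv 3) (hv 4) (hv 5)
      exact Subtype.ext h0
    have := LinearMap.finrank_le_finrank_of_injective hinj
    simpa using this
  have h := finrank_le_slice_add_killed U01 U02 U12 W Y K01 K02 K12 c d a b e hcov hK01 hK02 hK12 k01 k02 k12 hKc hY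
    hWs hWd hWc
  have d1 := Submodule.finrank_mono hC01
  have d2 := Submodule.finrank_mono hC02
  have d3 := Submodule.finrank_mono hC12
  omega

end LaplaceFiveSeparatedCapture

end Summit.ValiantsHypothesis.ValiantsHypothesis.Theorems.RigidityForcesSymmetryRankRigidMinimalRepr
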